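import Summits.AtomisticToContinuum.HydrodynamicLimit.Theorems.StiffCollisionalRelaxationAprioriBoundsEquilibriumStatics

/-!
# The equilibrium rung of component (i) of the a-priori crux, for EVERY hard-sphere flow

Supporting file (2 of 2) of the line `Sketch` for the crux `AprioriBounds` (stmt-AtomisticToContinuum-14827;
`StiffCollisionalRelaxation.AprioriBounds` = `CollisionIsometryCLT.AprioriBoundsPreShock`), lead prover
`prover-line-stmt-AtomisticToContinuum-14827-c1-0`, stub `stub_partOne` (= component (i) of the crux verbatim).

The standing disprover showed (`Theorems/AprioriBounds/Negative/EquilibriumRung.lean`,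
`equilibriumAprioriBounds_of_aprioriBounds`) that the crux implies, unconditionally, its EQUILIBRIUM RUNG
`EquilibriumAprioriBounds`: at the homogeneous local Gibbs states `(a₀, θ₀, u₀) = (1, θ₀, 0)`, for all small
`σ`, EVERY flow family and EVERY horizon `t > 0`, components (i) and (ii) hold — "believed TRUE; unproved;
the first place a counterexample would have to live".  This file PROVES the (i)-half of that rung
(`partOneAt_equilibrium`): for `σ ≤ 1/2`, `θ₀ > 0`, every family of hard-sphere flows `Φ` and every
`t > 0`, `PartOneAt σ 1 θ₀ 0 Φ t` holds with the explicit witness `λ = 1/(8θ₀)`, `C = t·m + 1`,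
`m = E_{N(0,θ₀)} e^{λ|v|²}` (so `λ < 1/(2θ₀)`, as the landed `Negative/CriticalLambda.lean` forces).
Corollaries: `equilibriumAprioriBounds_partOne` (the rung's quantifier shape) and `partOne_homogeneous`
(the registered `stub_partOne` verbatim at homogeneous data — its prefix is then idle).

Proof (`Theorems/StiffCollisionalRelaxationAprioriBoundsEquilibriumStatics.lean` supplies the lemmas): on a
good orbit `∫₀ᵗ G_N(Φ_s z) ds ≤ t·m + ∫₀ᵗ |G_N(Φ_s z) − m| ds` (energy conservation bounds the integrand,
`AprioriBoundsNegative.expAvg_le_exp_lam_energy`); the law is carried by the good set and invariant under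
every `Φ_s`, so by Tonelli `E ∫₀ᵗ |G_N∘Φ_s − m| ds = t·E|G_N − m| ≤ t(ε + E(G_N − m)²/(4ε))
≤ t(ε + Var/(4ε(N+1)))` for every `ε > 0`; Markov finishes.

No new definitions, no named facts; axioms `propext`, `Classical.choice`, `Quot.sound`.
-/

noncomputable section

open MeasureTheory ProbabilityTheory Filter Set Topology
open scoped ENNReal

namespace Summit.AtomisticToContinuum.HydrodynamicLimit.Theorems.AdiabatCeiling

open Literature.MathematicalPhysics.KineticTheory Literature.Analysis.FluidPDE

/-! ## Tonelli along the flow and Markov: the equilibrium rung of (i) -/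

/-- **THE EQUILIBRIUM RUNG OF (i), FOR EVERY FLOW.**  For `σ ≤ 1/2`, `θ₀ > 0`, every family `Φ` of
hard-sphere flows of `N + 1` spheres of diameter `σ(N+1)^{-1/3}` on `𝕋³` and every horizon `t > 0`,
component (i) of the crux holds at the homogeneous local Gibbs data `(a₀, θ₀, u₀) = (1, θ₀, 0)`:
with `λ = 1/(8θ₀)` and `C = t·E_{N(0,θ₀)}e^{λ|v|²} + 1`,
`P_N{C < ∫₀ᵗ (N+1)⁻¹∑ᵢ e^{λ|vᵢ(s)|²} ds} → 0`.  This is the (i)-half of the disprover's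
`AprioriBoundsNegative.EquilibriumAprioriBounds` (there stated for `σ < σ₀`; here for all `σ ≤ 1/2`).
Proof: §1 invariance, §2 static L² law of large numbers, §3 Tonelli + Markov:
`P_N(bad) ≤ t·E|G_N − m| ≤ t(ε + Var/(4ε(N+1)))` for every `ε > 0`. -/
theorem partOneAt_equilibrium {σ θ₀ : ℝ} (hσ2 : σ ≤ 1 / 2) (hθ : 0 < θ₀)
    (Φ : (N : ℕ) → HardSphereFlow (Torus.geometry (Fin 3)) (hsDiameter σ N) (N + 1)) {t : ℝ}
    (ht : 0 < t) :
    AprioriBoundsNegative.PartOneAt σ (fun _ => 1) (fun _ => θ₀) (fun _ => 0) Φ t := by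
  -- the witnesses
  set lam : ℝ := 1 / (8 * θ₀) with hlamdef
  have hlam0 : 0 < lam := by positivity
  have hlam : lam < 1 / (4 * θ₀) := by
    rw [hlamdef, div_lt_div_iff_of_pos_left one_pos (by positivity) (by positivity)]
    linarith
  set γ : Measure V3 := gaussMeasure (0 : V3) θ₀ with hγ
  set m : ℝ := ∫ v, Real.exp (lam * ‖v‖ ^ 2) ∂γ with hm
  set B : ℝ := Var[fun v : V3 => Real.exp (lam * ‖v‖ ^ 2); γ] with hB
  have hB0 : 0 ≤ B := variance_nonneg _ _
  refine ⟨lam, t * m + 1, hlam0, ?_⟩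
  -- the laws, the empirical moment and its centred absolute value
  set P : (N : ℕ) → Measure (Config (N + 1) (Fin 3) T3) :=
    fun N => localGibbsMeasure σ (fun _ => 1) (fun _ => 0) (fun _ => θ₀) N with hP
  haveI hprob : ∀ N, IsProbabilityMeasure (P N) := fun N =>
    isProbabilityMeasure_localGibbsMeasure (u₀ := fun _ => (0 : V3)) continuous_const continuous_const
      continuous_const (fun _ => one_pos) (fun _ => hθ) hσ2 N
  set G : (N : ℕ) → Config (N + 1) (Fin 3) T3 → ℝ :=
    fun N z => ((N + 1 : ℕ) : ℝ)⁻¹ * ∑ i, Real.exp (lam * ‖(z i).2‖ ^ 2) with hG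
  have hGm : ∀ N, Measurable (G N) := fun N =>
    measurable_const.mul (Finset.measurable_sum _ fun i _ =>
      (measurable_pi_apply i).snd.norm.pow_const 2 |>.const_mul lam |>.exp)
  have hG0 : ∀ N z, 0 ≤ G N z := fun N z =>
    mul_nonneg (by positivity) (Finset.sum_nonneg fun i _ => (Real.exp_pos _).le)
  set Hf : (N : ℕ) → Config (N + 1) (Fin 3) T3 → ℝ := fun N z => |G N z - m| with hHf
  have hHm : ∀ N, Measurable (Hf N) := fun N => ((hGm N).sub measurable_const).abs
  have hgood0 : ∀ N, P N (Φ N).goodᶜ = 0 := fun N =>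
    (localGibbsMeasure_absolutelyContinuous σ _ _ _ N (Φ N)) (Φ N).measure_compl_good
  have hinv : ∀ N s, MeasurePreserving ((Φ N).flow s) (P N) (P N) := fun N s =>
    measurePreserving_flow_localGibbsMeasure_homogeneous σ θ₀ N (Φ N) s
  -- STEP A: the bound for every `ε > 0` and every `N`
  have hbound : ∀ ε : ℝ, 0 < ε → ∀ N : ℕ,
      localGibbsLaw σ (fun _ => 1) (fun _ => 0) (fun _ => θ₀) N (Φ N)
        {z | t * m + 1 < ∫ s in Icc 0 t, ∫ y, Real.exp (lam * ‖y.2‖ ^ 2)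
          ∂(empiricalMeasure ((Φ N).flow s z))} ≤
      ENNReal.ofReal (t * ε + t / (4 * ε) * (B / ((N + 1 : ℕ) : ℝ))) := by
    intro ε hε N
    rw [localGibbsLaw_eq]
    have hev : {z : Config (N + 1) (Fin 3) T3 | t * m + 1 < ∫ s in Icc 0 t, ∫ y, Real.exp (lam * ‖y.2‖ ^ 2)
        ∂(empiricalMeasure ((Φ N).flow s z))} = {z | t * m + 1 < ∫ s in Icc 0 t, G N ((Φ N).flow s z)} := by
      ext z
      simp only [mem_setOf_eq, hG, integral_empiricalMeasure]
    rw [hev]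
    set ν : Measure ℝ := volume.restrict (Icc 0 t) with hν
    have hνuniv : ν univ = ENNReal.ofReal t := by
      rw [hν, Measure.restrict_apply_univ, Real.volume_Icc, sub_zero]
    set X : Config (N + 1) (Fin 3) T3 → ℝ≥0∞ := fun z => ∫⁻ s, ENNReal.ofReal (Hf N ((Φ N).flow s z)) ∂ν
      with hX
    -- (1) on the good set the bad event forces `1 ≤ X`
    have hincl : {z | t * m + 1 < ∫ s in Icc 0 t, G N ((Φ N).flow s z)} ∩ (Φ N).good ⊆ {z | 1 ≤ X z} := by
      rintro z ⟨hz1, hz⟩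
      simp only [mem_setOf_eq] at hz1 ⊢
      have horb : Measurable fun s => (Φ N).flow s z := ((Φ N).isTrajectory z hz).measurable_torus
      have hbdd : ∀ s, G N ((Φ N).flow s z) ≤ Real.exp (lam * (2 * configEnergy z)) := by
        intro s
        have h := AprioriBoundsNegative.expAvg_le_exp_lam_energy (N := N) hlam0.le ((Φ N).flow s z)
        rw [(Φ N).configEnergy_flow hz s] at h
        exact h
      have hGi : Integrable (fun s => G N ((Φ N).flow s z)) ν := by
        refine Measure.integrableOn_of_bounded (M := Real.exp (lam * (2 * configEnergy z)))
          measure_Icc_lt_top.ne ((hGm N).comp horb).aestronglyMeasurable (ae_of_all _ fun s => ?_)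
        rw [Real.norm_eq_abs, abs_of_nonneg (hG0 N _)]
        exact hbdd s
      have hHi : Integrable (fun s => Hf N ((Φ N).flow s z)) ν := (hGi.sub (integrable_const m)).abs
      have hsplit : ∫ s, G N ((Φ N).flow s z) ∂ν = (∫ s, (G N ((Φ N).flow s z) - m) ∂ν) + t * m := by
        rw [integral_sub hGi (integrable_const m), integral_const, smul_eq_mul]
        have : ν.real univ = t := by
          rw [measureReal_def, hνuniv, ENNReal.toReal_ofReal ht.le]
        rw [this]
        ring
      have hle : ∫ s, (G N ((Φ N).flow s z) - m) ∂ν ≤ ∫ s, Hf N ((Φ N).flow s z) ∂ν :=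
        integral_mono (hGi.sub (integrable_const m)) hHi fun s => le_abs_self _
      have h1 : 1 < ∫ s, Hf N ((Φ N).flow s z) ∂ν := by
        have : t * m + 1 < (∫ s, (G N ((Φ N).flow s z) - m) ∂ν) + t * m := by rw [← hsplit]; exact hz1
        linarith
      have hXz : X z = ENNReal.ofReal (∫ s, Hf N ((Φ N).flow s z) ∂ν) := by
        rw [hX]
        exact (ofReal_integral_eq_lintegral_ofReal hHi (ae_of_all _ fun s => abs_nonneg _)).symm
      rw [hXz, ← ENNReal.ofReal_one]
      exact ENNReal.ofReal_le_ofReal h1.le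
    -- (2) + (3): Markov
    obtain ⟨hXm, hTon⟩ := lintegral_lintegral_comp_flow_eq (Φ N) (hHm N).ennreal_ofReal (hgood0 N)
      (hinv N) ν
    have hPE : P N {z | t * m + 1 < ∫ s in Icc 0 t, G N ((Φ N).flow s z)} ≤ ∫⁻ z, X z ∂P N := by
      calc P N {z | t * m + 1 < ∫ s in Icc 0 t, G N ((Φ N).flow s z)}
          ≤ P N (({z | t * m + 1 < ∫ s in Icc 0 t, G N ((Φ N).flow s z)} ∩ (Φ N).good) ∪ (Φ N).goodᶜ) :=
            measure_mono fun z hz => by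
              by_cases h : z ∈ (Φ N).good
              · exact Or.inl ⟨hz, h⟩
              · exact Or.inr h
        _ ≤ P N ({z | t * m + 1 < ∫ s in Icc 0 t, G N ((Φ N).flow s z)} ∩ (Φ N).good) + P N (Φ N).goodᶜ :=
            measure_union_le _ _
        _ = P N ({z | t * m + 1 < ∫ s in Icc 0 t, G N ((Φ N).flow s z)} ∩ (Φ N).good) := by
            rw [hgood0 N, add_zero]
        _ ≤ P N {z | 1 ≤ X z} := measure_mono hincl
        _ = 1 * P N {z | 1 ≤ X z} := (one_mul _).symm
        _ ≤ ∫⁻ z, X z ∂P N := mul_meas_ge_le_lintegral₀ hXm 1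
    -- (4) Tonelli + invariance
    have hTon' : ∫⁻ z, X z ∂P N = (∫⁻ z, ENNReal.ofReal (Hf N z) ∂P N) * ENNReal.ofReal t := by
      rw [hX]
      exact hTon.trans (by rw [hνuniv])
    -- (5) the static bound `E|G - m| ≤ ε + E(G - m)²/(4ε)`
    have hstat : ∫⁻ z, ENNReal.ofReal (Hf N z) ∂P N ≤
        ENNReal.ofReal ε + ENNReal.ofReal (1 / (4 * ε)) * ENNReal.ofReal (B / ((N + 1 : ℕ) : ℝ)) := by
      have hsq := lintegral_sq_expAvg_sub_le hσ2 hθ hlam N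
      calc ∫⁻ z, ENNReal.ofReal (Hf N z) ∂P N
          ≤ ∫⁻ z, (ENNReal.ofReal ε + ENNReal.ofReal (1 / (4 * ε)) * ENNReal.ofReal ((G N z - m) ^ 2)) ∂P N := by
            refine lintegral_mono fun z => ?_
            rw [hHf]
            dsimp only
            rw [← ENNReal.ofReal_mul (by positivity), ← ENNReal.ofReal_add hε.le (by positivity)]
            refine ENNReal.ofReal_le_ofReal ?_
            have h := abs_le_add_sq_div (y := G N z - m) hε
            calc |G N z - m| ≤ ε + (G N z - m) ^ 2 / (4 * ε) := h
              _ = ε + 1 / (4 * ε) * (G N z - m) ^ 2 := by ring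
        _ = ENNReal.ofReal ε + ENNReal.ofReal (1 / (4 * ε)) * ∫⁻ z, ENNReal.ofReal ((G N z - m) ^ 2) ∂P N := by
            rw [lintegral_add_left measurable_const, lintegral_const, measure_univ, mul_one,
              lintegral_const_mul (ENNReal.ofReal (1 / (4 * ε)))
                (f := fun z => ENNReal.ofReal ((G N z - m) ^ 2))
                (((hGm N).sub_const m).pow_const 2).ennreal_ofReal]
        _ ≤ ENNReal.ofReal ε + ENNReal.ofReal (1 / (4 * ε)) * ENNReal.ofReal (B / ((N + 1 : ℕ) : ℝ)) :=
            add_le_add le_rfl (mul_le_mul' le_rfl hsq)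
    -- assemble
    calc P N {z | t * m + 1 < ∫ s in Icc 0 t, G N ((Φ N).flow s z)}
        ≤ ∫⁻ z, X z ∂P N := hPE
      _ = (∫⁻ z, ENNReal.ofReal (Hf N z) ∂P N) * ENNReal.ofReal t := hTon'
      _ ≤ (ENNReal.ofReal ε + ENNReal.ofReal (1 / (4 * ε)) * ENNReal.ofReal (B / ((N + 1 : ℕ) : ℝ))) *
            ENNReal.ofReal t := mul_le_mul' hstat le_rfl
      _ = ENNReal.ofReal (t * ε + t / (4 * ε) * (B / ((N + 1 : ℕ) : ℝ))) := by
            rw [← ENNReal.ofReal_mul (by positivity), ← ENNReal.ofReal_add hε.le (by positivity),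
              ← ENNReal.ofReal_mul (by positivity)]
            congr 1
            ring
  -- STEP B: the bound tends to zero
  refine ENNReal.tendsto_nhds_zero.2 fun η hη => ?_
  by_cases hηtop : η = ⊤
  · exact Eventually.of_forall fun N => hηtop ▸ le_top
  have hη' : 0 < η.toReal := ENNReal.toReal_pos hη.ne' hηtop
  set ε : ℝ := η.toReal / (2 * t) with hεdef
  have hε : 0 < ε := by positivity
  have htε : t * ε = η.toReal / 2 := by
    rw [hεdef]; field_simp
  have hlim : Tendsto (fun N : ℕ => t / (4 * ε) * (B / ((N + 1 : ℕ) : ℝ))) atTop (𝓝 0) := by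
    have h := ((tendsto_const_div_atTop_nhds_zero_nat B).comp (tendsto_add_atTop_nat 1)).const_mul
      (t / (4 * ε))
    rw [mul_zero] at h
    exact h
  have hev := (tendsto_order.1 hlim).2 (η.toReal / 2) (by positivity)
  filter_upwards [hev] with N hN
  refine (hbound ε hε N).trans ?_
  calc ENNReal.ofReal (t * ε + t / (4 * ε) * (B / ((N + 1 : ℕ) : ℝ)))
      ≤ ENNReal.ofReal (η.toReal) := ENNReal.ofReal_le_ofReal (by rw [htε]; linarith)
    _ ≤ η := ENNReal.ofReal_toReal_le

/-- **The (i)-half of `EquilibriumAprioriBounds`** in its own quantifier shape (`σ₀ := 1/2`): for every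
`θ₀ > 0`, all `0 < σ < 1/2`, every flow family and every `t > 0`, `PartOneAt σ 1 θ₀ 0 Φ t`. -/
theorem equilibriumAprioriBounds_partOne :
    ∀ θ₀ : ℝ, 0 < θ₀ → ∃ σ₀ : ℝ, 0 < σ₀ ∧ ∀ σ : ℝ, 0 < σ → σ < σ₀ →
      ∀ Φ : (N : ℕ) → HardSphereFlow (Torus.geometry (Fin 3)) (hsDiameter σ N) (N + 1),
        ∀ t : ℝ, 0 < t → AprioriBoundsNegative.PartOneAt σ (fun _ => 1) (fun _ => θ₀) (fun _ => 0) Φ t :=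
  fun _θ₀ hθ => ⟨1 / 2, one_half_pos, fun _σ _ hσ Φ _t ht => partOneAt_equilibrium hσ.le hθ Φ ht⟩

/-- **`stub_partOne` AT HOMOGENEOUS DATA** (the registered stub of the line `Sketch`, verbatim, specialised to
the profiles `(a₀, θ₀, u₀) = (1, θ₀, 0)`): the whole crux prefix (classical solution, `t = 0` law of large
numbers, horizon `t < T`, dilute chamber) is then not even needed — `σ₀ := 1/2`, `η₁ := 1`, and
`partOneAt_equilibrium` applies to every flow family and every `t > 0`. -/
theorem partOne_homogeneous (θ₀ : ℝ) (hθ : 0 < θ₀) :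
    ∃ σ₀ : ℝ, 0 < σ₀ ∧ ∃ η₁ : ℝ, 0 < η₁ ∧ ∀ σ : ℝ, 0 < σ → σ < σ₀ →
      ∀ (T : ℝ) (ρ θ : ℝ → T3 → ℝ) (u : ℝ → T3 → V3), IsHardSphereEulerSolution σ T ρ u θ →
      ∀ Φ : (N : ℕ) → HardSphereFlow (Torus.geometry (Fin 3)) (hsDiameter σ N) (N + 1),
        TendstoHydroFieldsAt
            (fun N => localGibbsLaw σ (fun _ => 1) (fun _ => 0) (fun _ => θ₀) N (Φ N)) Φ ρ u θ 0 →
        ∀ t : ℝ, 0 < t → t < T → (∀ s ∈ Icc 0 t, ∀ x, 2 * ρ s x * σ ^ 3 < η₁) →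
          ∃ lam Cexp : ℝ, 0 < lam ∧ Tendsto (fun N : ℕ =>
            localGibbsLaw σ (fun _ => 1) (fun _ => 0) (fun _ => θ₀) N (Φ N)
              {z | Cexp < ∫ s in Icc 0 t, ∫ y, Real.exp (lam * ‖y.2‖ ^ 2)
                ∂(empiricalMeasure ((Φ N).flow s z))}) atTop (𝓝 0) :=
  ⟨1 / 2, one_half_pos, 1, one_pos, fun _σ _ hσ _T _ρ _θ _u _ Φ _ _t ht _ _ =>
    partOneAt_equilibrium hσ.le hθ Φ ht⟩

end Summit.AtomisticToContinuum.HydrodynamicLimit.Theorems.AdiabatCeiling
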